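import Summits.NavierStokesRegularity.NavierStokesRegularity.Theses.AxisymmetricExtremality
import Summits.NavierStokesRegularity.NavierStokesRegularity.Theorems.AxisymmetricExtremalityMinimalDatumPFoldThresholdFinite
import Summits.NavierStokesRegularity.NavierStokesRegularity.Theorems.AxisymmetricExtremalityMinimalDatumPFoldNotAeZero
import Summits.NavierStokesRegularity.NavierStokesRegularity.Theorems.AxisymmetricExtremalityMinimalDatumPFoldRecentre
import Summits.NavierStokesRegularity.NavierStokesRegularity.Theorems.AxisymmetricExtremalityMinimalDatumPFoldAeToExact
import Summits.NavierStokesRegularity.NavierStokesRegularity.Theorems.AxisymmetricExtremalityMinimalDatumPFoldSymmetryDefectInLimit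
import Summits.NavierStokesRegularity.NavierStokesRegularity.Theorems.AxisymmetricExtremalityMinimalDatumPFoldUniformRegularity
import Summits.NavierStokesRegularity.NavierStokesRegularity.Theorems.AxisymmetricExtremalityMinimalDatumPFoldConcentrationWeakLimitBlowup
import Summits.NavierStokesRegularity.NavierStokesRegularity.Theorems.AxisymmetricExtremalityMinimalDatumPFoldConcentrationNearMinimalLimit
import Summits.NavierStokesRegularity.NavierStokesRegularity.Theorems.AxisymmetricExtremalityMinimalDatumPFoldBranchOfAxisymMinimalDatum
import Summits.NavierStokesRegularity.NavierStokesRegularity.Theorems.AxisymmetricExtremalityPFoldToAxisymmetric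

/-!
# Route AxisymmetricExtremality — crux `MinimalDatumPFold` (stmt-NavierStokesRegularity-15452) is EQUIVALENT to axisymmetric sub-threshold concentration

Line `Sketch` of the crux (idea `subthreshold-dissipation-branch`, `Cruxes/MinimalDatumPFold/Lines/Sketch.lean`, lead c2):
the crux `MinimalDatumPFold` (Clay failure at `ν` ⇒ exactly `R_{2π/p}`-equivariant Rusin–Šverák minimal blow-up data
for unboundedly many `p`) is reduced to — and shown EQUIVALENT to — ONE statement about GLOBAL solutions only, the
**axisymmetric sub-threshold concentration branch** (`stub_axisymConcentrationBranch`, the line's open residual):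
Clay failure at `ν` ⇒ there is a sequence of exactly axisymmetric admissible data `U k` of critical norm
`< ρ_max^pure(ν)` (hence global) whose Kato solutions on `[0, 1)` CONCENTRATE at points `(1, x k)` — for every
radius `r` the essential suprema of `|u k|` on the backward parabolic cylinders `Q_r(1, x k)` tend to `∞`.

* `minimalDatumPFold_of_axisymConcentrationBranch` (branch ⇒ crux): `ρ_max^pure(ν) < ⊤`
  (`stub_thresholdFinite_of_clayFailure`); the concentrating sequence has, modulo `Sim` and along a subsequence, a
  STRONG `L³` limit which is a minimal blow-up datum (`stub_concentrationNearMinimalLimit` ∘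
  `stub_concentrationWeakLimitBlowup` ∘ `stub_uniformRegularity`: weak compactness, Rusin–Šverák's Cor. 4.2 run with the
  quantitative ε-regularity criterion RRS 2016 Thm. 15.3, norm squeeze, Radon–Riesz); the `R_{2π/p}`-symmetry survives up
  to a horizontal shift (`stub_symmetryDefectInLimit`), is recentred (`stub_liftRecentre`) and made exact
  (`stub_liftAeToExact`), `p := max N 2`.
* `axisymConcentrationBranch_of_minimalDatumPFold` (crux ⇒ branch): the PROVED sibling crux `PFoldToAxisymmetric`
  gives an axisymmetric minimal datum, and `stub_branchOfAxisymMinimalDatum` (strong stability of its singular point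
  under `U k := (1 - (k+2)⁻¹)•ψ`) the branch.
* `minimalDatumPFold_iff_axisymConcentrationBranch`: the equivalence.

So the crux's whole open content is, kernel-checked, the existence of CONCENTRATING axisymmetric sub-threshold (global)
Kato solutions at a viscosity where Clay (A) fails — no blow-up object, no minimality, no moduli space `M̂`.

References: W. Rusin, V. Šverák, J. Funct. Anal. 260 (2011) 879–891 = arXiv:0911.0500, Cor. 4.2–4.3 and proofs
[RusinSverak2011]; J. C. Robinson, J. L. Rodrigo, W. Sadowski (2016), Thm. 15.3 [RobinsonRodrigoSadowski2016];
crux card `Cruxes/MinimalDatumPFold/Ideas/subthreshold-dissipation-branch.md`.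
-/

set_option linter.dupNamespace false

noncomputable section

namespace Summit.NavierStokesRegularity.NavierStokesRegularity.Theorems

/-- **Branch ⇒ crux.** If at every `ν > 0` where Clay (A) fails there is a sequence of exactly axisymmetric
sub-threshold admissible data whose Kato solutions on `[0,1)` concentrate at `(1, x k)` (the statement of the registered
stub `stub_axisymConcentrationBranch` of line `Sketch`), then `AxisymmetricExtremality.MinimalDatumPFold` holds. Proof: the
line's composition — threshold finite, strong `L³` limit in `M` modulo `Sim` (three landed stubs), symmetry defect,
recentring, exactness, `p := max N 2`. [cite: RusinSverak2011, Cor. 4.3 and its proof (arXiv:0911.0500 p. 8)] -/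
theorem minimalDatumPFold_of_axisymConcentrationBranch
    (hB : ∀ ν : ℝ, 0 < ν → (∃ v₀ : EuclideanSpace ℝ (Fin 3) → EuclideanSpace ℝ (Fin 3), ContDiff ℝ (⊤ : ℕ∞) v₀ ∧ Literature.Analysis.FluidPDE.NSWave0.IsDivFree v₀ ∧ Literature.Analysis.FluidPDE.HasRapidSpatialDecay v₀ ∧ ¬ ∃ (u : ℝ → EuclideanSpace ℝ (Fin 3) → EuclideanSpace ℝ (Fin 3)) (p : ℝ → EuclideanSpace ℝ (Fin 3) → ℝ), Literature.Analysis.FluidPDE.IsSmoothOnHalfSpace u ∧ Literature.Analysis.FluidPDE.IsSmoothOnHalfSpace p ∧ Literature.Analysis.FluidPDE.IsNavierStokesSolution ν 0 v₀ u p ∧ Literature.Analysis.FluidPDE.HasBoundedEnergy u) → ∃ (U : ℕ → EuclideanSpace ℝ (Fin 3) → EuclideanSpace ℝ (Fin 3)) (G : ℕ → Literature.Analysis.FunctionSpaces.HomSobolev (EuclideanSpace ℝ (Fin 3)) (EuclideanSpace ℂ (Fin 3)) (1 / 2 : ℝ)) (u : ℕ → ℝ → EuclideanSpace ℝ (Fin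 3) → EuclideanSpace ℝ (Fin 3)) (x : ℕ → EuclideanSpace ℝ (Fin 3)), (∀ k, MeasureTheory.MemLp (U k) 3 (MeasureTheory.volume : MeasureTheory.Measure (EuclideanSpace ℝ (Fin 3))) ∧ (G k).Represents (Literature.Analysis.FunctionSpaces.EuclideanSpace.complexify ∘ U k) ∧ Literature.Analysis.FluidPDE.IsWeaklyDivFree (U k) ∧ ‖G k‖ₑ < Literature.Analysis.FluidPDE.rusinSverakRhoMaxPure ν) ∧ (∀ k, Literature.Analysis.FluidPDE.IsMildNSSolutionOn (Set.Ico 0 1) ν 0 (U k) (u k) ∧ Literature.Analysis.FluidPDE.ContinuousInLpOn (Set.Ico 0 1) 3 (u k) ∧ u k 0 = U k ∧ MeasureTheory.AEStronglyMeasurable (Function.uncurry (u k)) (MeasureTheory.volume.restrict (Set.Ioo (0 : ℝ) 1 ×ˢ (Set.univ : Set (EuclideanSpace ℝ (Fin 3)))))) ∧ (∀ r : ℝ, 0 < r → Filter.Tendsto (fun k => MeasureTheory.eLpNorm (Function.uncurry (u k)) ⊤ (MeasureTheory.volume.restrict (Literature.Analysis.FluidPDE.parabolicCylinder r ((1 :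 ℝ), x k)))) Filter.atTop (nhds ⊤)) ∧ (∀ k (θ : ℝ) (y : EuclideanSpace ℝ (Fin 3)), U k (WithLp.toLp 2 ![Real.cos θ * y 0 - Real.sin θ * y 1, Real.sin θ * y 0 + Real.cos θ * y 1, y 2]) = WithLp.toLp 2 ![Real.cos θ * U k y 0 - Real.sin θ * U k y 1, Real.sin θ * U k y 0 + Real.cos θ * U k y 1, U k y 2])) :
    Summit.NavierStokesRegularity.NavierStokesRegularity.Theses.AxisymmetricExtremality.MinimalDatumPFold := by
  intro ν hν hclay N
  have hfin : Literature.Analysis.FluidPDE.rusinSverakRhoMaxPure ν < ⊤ :=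
    stub_thresholdFinite_of_clayFailure ν hν hclay
  set p : ℕ := max N 2 with hp_def
  have hNp : N ≤ p := le_max_left _ _
  have h2p : 2 ≤ p := le_max_right _ _
  obtain ⟨U, G, u, x, hadm, hkato, hconc, hax⟩ := hB ν hν hclay
  obtain ⟨lam, x₀, φ, v, g, hlam, _hφ, hmin, htend⟩ :=
    stub_concentrationNearMinimalLimit (stub_concentrationWeakLimitBlowup stub_uniformRegularity)
      ν hν hfin U G u x hadm hkato hconc
  have hne := stub_minimalDatum_not_aeZero ν v g hmin
  have hL3 : MeasureTheory.MemLp v 3 (MeasureTheory.volume : MeasureTheory.Measure (EuclideanSpace ℝ (Fin 3))) :=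
    hmin.1
  -- exact axisymmetry of the data gives a.e. `R_{2π/p}`-equivariance of the extracted subsequence
  have hsym : ∀ j, ∀ᵐ y ∂(MeasureTheory.volume : MeasureTheory.Measure (EuclideanSpace ℝ (Fin 3))),
      U (φ j) (WithLp.toLp 2 ![Real.cos (2 * Real.pi / p) * y 0 - Real.sin (2 * Real.pi / p) * y 1, Real.sin (2 * Real.pi / p) * y 0 + Real.cos (2 * Real.pi / p) * y 1, y 2]) = WithLp.toLp 2 ![Real.cos (2 * Real.pi / p) * U (φ j) y 0 - Real.sin (2 * Real.pi / p) * U (φ j) y 1, Real.sin (2 * Real.pi / p) * U (φ j) y 0 + Real.cos (2 * Real.pi / p) * U (φ j) y 1, U (φ j) y 2] :=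
    fun j => Filter.Eventually.of_forall fun y => hax (φ j) (2 * Real.pi / p) y
  obtain ⟨x₁, hx₁, hfix⟩ := stub_symmetryDefectInLimit p (fun j => U (φ j)) lam x₀ v
    (fun j => (hadm (φ j)).1) hsym hlam hL3 hne htend
  obtain ⟨u₁, g₁, hmin₁, hfix₁⟩ := stub_liftRecentre ν p h2p v g hmin x₁ hx₁ hfix
  obtain ⟨u₂, g₂, hmin₂, hsym₂⟩ := stub_liftAeToExact ν p h2p u₁ g₁ hmin₁ hfix₁
  exact ⟨p, hNp, h2p, u₂, g₂, hmin₂, hsym₂⟩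

/-- **Crux ⇒ branch.** `MinimalDatumPFold` implies the axisymmetric sub-threshold concentration branch: the PROVED
sibling crux `PFoldToAxisymmetric` (`axisymmetricExtremality_pFoldToAxisymmetric_proof`) turns p-fold minimal data for
unboundedly many `p` into an axisymmetric minimal blow-up datum, and the landed `stub_branchOfAxisymMinimalDatum` (strong
stability of its singular point) into the concentrating sub-threshold sequence. [cite: RusinSverak2011, Thm. 4.2 and
Cor. 4.2 (arXiv:0911.0500 pp. 7–8)] -/
theorem axisymConcentrationBranch_of_minimalDatumPFold
    (h : Summit.NavierStokesRegularity.NavierStokesRegularity.Theses.AxisymmetricExtremality.MinimalDatumPFold) :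
    ∀ ν : ℝ, 0 < ν → (∃ v₀ : EuclideanSpace ℝ (Fin 3) → EuclideanSpace ℝ (Fin 3), ContDiff ℝ (⊤ : ℕ∞) v₀ ∧ Literature.Analysis.FluidPDE.NSWave0.IsDivFree v₀ ∧ Literature.Analysis.FluidPDE.HasRapidSpatialDecay v₀ ∧ ¬ ∃ (u : ℝ → EuclideanSpace ℝ (Fin 3) → EuclideanSpace ℝ (Fin 3)) (p : ℝ → EuclideanSpace ℝ (Fin 3) → ℝ), Literature.Analysis.FluidPDE.IsSmoothOnHalfSpace u ∧ Literature.Analysis.FluidPDE.IsSmoothOnHalfSpace p ∧ Literature.Analysis.FluidPDE.IsNavierStokesSolution ν 0 v₀ u p ∧ Literature.Analysis.FluidPDE.HasBoundedEnergy u) → ∃ (U : ℕ → EuclideanSpace ℝ (Fin 3) → EuclideanSpace ℝ (Fin 3)) (G : ℕ → Literature.Analysis.FunctionSpaces.HomSobolev (EuclideanSpace ℝ (Fin 3)) (EuclideanSpace ℂ (Fin 3)) (1 / 2 : ℝ)) (u : ℕ → ℝ → EuclideanSpace ℝ (Fin 3) → EuclideanSpace ℝ (Fin 3)) (x : ℕ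 → EuclideanSpace ℝ (Fin 3)), (∀ k, MeasureTheory.MemLp (U k) 3 (MeasureTheory.volume : MeasureTheory.Measure (EuclideanSpace ℝ (Fin 3))) ∧ (G k).Represents (Literature.Analysis.FunctionSpaces.EuclideanSpace.complexify ∘ U k) ∧ Literature.Analysis.FluidPDE.IsWeaklyDivFree (U k) ∧ ‖G k‖ₑ < Literature.Analysis.FluidPDE.rusinSverakRhoMaxPure ν) ∧ (∀ k, Literature.Analysis.FluidPDE.IsMildNSSolutionOn (Set.Ico 0 1) ν 0 (U k) (u k) ∧ Literature.Analysis.FluidPDE.ContinuousInLpOn (Set.Ico 0 1) 3 (u k) ∧ u k 0 = U k ∧ MeasureTheory.AEStronglyMeasurable (Function.uncurry (u k)) (MeasureTheory.volume.restrict (Set.Ioo (0 : ℝ) 1 ×ˢ (Set.univ : Set (EuclideanSpace ℝ (Fin 3)))))) ∧ (∀ r : ℝ, 0 < r → Filter.Tendsto (fun k => MeasureTheory.eLpNorm (Function.uncurry (u k)) ⊤ (MeasureTheory.volume.restrict (Literature.Analysis.FluidPDE.parabolicCylinder r ((1 : ℝ), x k)))) Filter.atTop (nhds ⊤)) ∧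 (∀ k (θ : ℝ) (y : EuclideanSpace ℝ (Fin 3)), U k (WithLp.toLp 2 ![Real.cos θ * y 0 - Real.sin θ * y 1, Real.sin θ * y 0 + Real.cos θ * y 1, y 2]) = WithLp.toLp 2 ![Real.cos θ * U k y 0 - Real.sin θ * U k y 1, Real.sin θ * U k y 0 + Real.cos θ * U k y 1, U k y 2]) :=
  fun ν hν hclay => stub_branchOfAxisymMinimalDatum ν hν
    (axisymmetricExtremality_pFoldToAxisymmetric_proof ν hν (h ν hν hclay))

/-- **The crux `MinimalDatumPFold` is equivalent to the axisymmetric sub-threshold concentration branch** (line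
`Sketch`): its whole open content is the existence, at every viscosity where Clay (A) fails, of exactly axisymmetric
sub-threshold (hence GLOBAL) Kato solutions concentrating in the parabolic sense. [folklore] -/
theorem minimalDatumPFold_iff_axisymConcentrationBranch :
    Summit.NavierStokesRegularity.NavierStokesRegularity.Theses.AxisymmetricExtremality.MinimalDatumPFold ↔
    (∀ ν : ℝ, 0 < ν → (∃ v₀ : EuclideanSpace ℝ (Fin 3) → EuclideanSpace ℝ (Fin 3), ContDiff ℝ (⊤ : ℕ∞) v₀ ∧ Literature.Analysis.FluidPDE.NSWave0.IsDivFree v₀ ∧ Literature.Analysis.FluidPDE.HasRapidSpatialDecay v₀ ∧ ¬ ∃ (u : ℝ → EuclideanSpace ℝ (Fin 3) → EuclideanSpace ℝ (Fin 3)) (p : ℝ → EuclideanSpace ℝ (Fin 3) → ℝ), Literature.Analysis.FluidPDE.IsSmoothOnHalfSpace u ∧ Literature.Analysis.FluidPDE.IsSmoothOnHalfSpace p ∧ Literature.Analysis.FluidPDE.IsNavierStokesSolution ν 0 v₀ u p ∧ Literature.Analysis.FluidPDE.HasBoundedEnergy u) → ∃ (U : ℕ → EuclideanSpace ℝ (Fin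 3) → EuclideanSpace ℝ (Fin 3)) (G : ℕ → Literature.Analysis.FunctionSpaces.HomSobolev (EuclideanSpace ℝ (Fin 3)) (EuclideanSpace ℂ (Fin 3)) (1 / 2 : ℝ)) (u : ℕ → ℝ → EuclideanSpace ℝ (Fin 3) → EuclideanSpace ℝ (Fin 3)) (x : ℕ → EuclideanSpace ℝ (Fin 3)), (∀ k, MeasureTheory.MemLp (U k) 3 (MeasureTheory.volume : MeasureTheory.Measure (EuclideanSpace ℝ (Fin 3))) ∧ (G k).Represents (Literature.Analysis.FunctionSpaces.EuclideanSpace.complexify ∘ U k) ∧ Literature.Analysis.FluidPDE.IsWeaklyDivFree (U k) ∧ ‖G k‖ₑ < Literature.Analysis.FluidPDE.rusinSverakRhoMaxPure ν) ∧ (∀ k, Literature.Analysis.FluidPDE.IsMildNSSolutionOn (Set.Ico 0 1) ν 0 (U k) (u k) ∧ Literature.Analysis.FluidPDE.ContinuousInLpOn (Set.Ico 0 1) 3 (u k) ∧ u k 0 = U k ∧ MeasureTheory.AEStronglyMeasurable (Function.uncurry (u k)) (MeasureTheory.volume.restrict (Set.Ioo (0 : ℝ) 1 ×ˢ (Set.univ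 : Set (EuclideanSpace ℝ (Fin 3)))))) ∧ (∀ r : ℝ, 0 < r → Filter.Tendsto (fun k => MeasureTheory.eLpNorm (Function.uncurry (u k)) ⊤ (MeasureTheory.volume.restrict (Literature.Analysis.FluidPDE.parabolicCylinder r ((1 : ℝ), x k)))) Filter.atTop (nhds ⊤)) ∧ (∀ k (θ : ℝ) (y : EuclideanSpace ℝ (Fin 3)), U k (WithLp.toLp 2 ![Real.cos θ * y 0 - Real.sin θ * y 1, Real.sin θ * y 0 + Real.cos θ * y 1, y 2]) = WithLp.toLp 2 ![Real.cos θ * U k y 0 - Real.sin θ * U k y 1, Real.sin θ * U k y 0 + Real.cos θ * U k y 1, U k y 2])) :=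
  ⟨axisymConcentrationBranch_of_minimalDatumPFold, minimalDatumPFold_of_axisymConcentrationBranch⟩

/-- **Registered tools stub of line `Sketch`** (`ledger workitem stub-add … --name stub_minimalDatumPFoldIffBranch`): the
equivalence crux ⇔ axisymmetric sub-threshold concentration branch, by `minimalDatumPFold_iff_axisymConcentrationBranch`.
[folklore] -/
theorem stub_minimalDatumPFoldIffBranch : Summit.NavierStokesRegularity.NavierStokesRegularity.Theses.AxisymmetricExtremality.MinimalDatumPFold ↔ (∀ ν : ℝ, 0 < ν → (∃ v₀ : EuclideanSpace ℝ (Fin 3) → EuclideanSpace ℝ (Fin 3), ContDiff ℝ (⊤ : ℕ∞) v₀ ∧ Literature.Analysis.FluidPDE.NSWave0.IsDivFree v₀ ∧ Literature.Analysis.FluidPDE.HasRapidSpatialDecay v₀ ∧ ¬ ∃ (u : ℝ → EuclideanSpace ℝ (Fin 3) → EuclideanSpace ℝ (Fin 3)) (p : ℝ → EuclideanSpace ℝ (Fin 3) → ℝ), Literature.Analysis.FluidPDE.IsSmoothOnHalfSpace u ∧ Literature.Analysis.FluidPDE.IsSmoothOnHalfSpace p ∧ Literature.Analysis.FluidPDE.IsNavierStokesSolution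 ν 0 v₀ u p ∧ Literature.Analysis.FluidPDE.HasBoundedEnergy u) → ∃ (U : ℕ → EuclideanSpace ℝ (Fin 3) → EuclideanSpace ℝ (Fin 3)) (G : ℕ → Literature.Analysis.FunctionSpaces.HomSobolev (EuclideanSpace ℝ (Fin 3)) (EuclideanSpace ℂ (Fin 3)) (1 / 2 : ℝ)) (u : ℕ → ℝ → EuclideanSpace ℝ (Fin 3) → EuclideanSpace ℝ (Fin 3)) (x : ℕ → EuclideanSpace ℝ (Fin 3)), (∀ k, MeasureTheory.MemLp (U k) 3 (MeasureTheory.volume : MeasureTheory.Measure (EuclideanSpace ℝ (Fin 3))) ∧ (G k).Represents (Literature.Analysis.FunctionSpaces.EuclideanSpace.complexify ∘ U k) ∧ Literature.Analysis.FluidPDE.IsWeaklyDivFree (U k) ∧ ‖G k‖ₑ < Literature.Analysis.FluidPDE.rusinSverakRhoMaxPure ν) ∧ (∀ k, Literature.Analysis.FluidPDE.IsMildNSSolutionOn (Set.Ico 0 1) ν 0 (U k) (u k) ∧ Literature.Analysis.FluidPDE.ContinuousInLpOn (Set.Ico 0 1) 3 (u k) ∧ u k 0 = U k ∧ MeasureTheory.AEStronglyMeasurable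 (Function.uncurry (u k)) (MeasureTheory.volume.restrict (Set.Ioo (0 : ℝ) 1 ×ˢ (Set.univ : Set (EuclideanSpace ℝ (Fin 3)))))) ∧ (∀ r : ℝ, 0 < r → Filter.Tendsto (fun k => MeasureTheory.eLpNorm (Function.uncurry (u k)) ⊤ (MeasureTheory.volume.restrict (Literature.Analysis.FluidPDE.parabolicCylinder r ((1 : ℝ), x k)))) Filter.atTop (nhds ⊤)) ∧ (∀ k (θ : ℝ) (y : EuclideanSpace ℝ (Fin 3)), U k (WithLp.toLp 2 ![Real.cos θ * y 0 - Real.sin θ * y 1, Real.sin θ * y 0 + Real.cos θ * y 1, y 2]) = WithLp.toLp 2 ![Real.cos θ * U k y 0 - Real.sin θ * U k y 1, Real.sin θ * U k y 0 + Real.cos θ * U k y 1, U k y 2])) :=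
  minimalDatumPFold_iff_axisymConcentrationBranch

end Summit.NavierStokesRegularity.NavierStokesRegularity.Theorems

end
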